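import Summits.CriticalPhenomena.PercolationContinuityZ3.Theorems.PercNearOneGluingNoHeavyLowerTailSahiGridPatternTopCubeCyl

/-!
# `NoHeavyLowerTail` (crux stmt-CriticalPhenomena-4575), Sahi programme P1: **EVERY HARRIS-GOOD SLOT IS GOOD IN EVERY DIMENSION** —
# the trivial diagonal certificate, stated once for all `U` with `sStarD U B C ≥ H(U,B∩C)`

Support file (Sahi cell, seat `prim-sahi-p1`, generation 19; `--supports stmt-CriticalPhenomena-4575`).  Pure proofs, NO definitions,
no `sorry`, standard axioms.  Vocabulary of `…SahiGridPattern{DiagCert,TopCubeCyl,OrthantHarris}`.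

THE MATHEMATICS.  Call an up-set `U ⊆ [3]^k` HARRIS-GOOD if `2^k·#(U∩B∩C) ≤ sStarD U B C + N(U;B∩C)` for all up-sets `B, C` (generations
16/18: `G(U;B,C) ≥ 0`; equivalently the TRIVIAL diagonal vector `d = 2^k·1_U` satisfies condition (N) of `…DiagCert`).  Proved Harris-good so
far: every principal up-set (`sStarD_principal_ge_harris`, generation 18) and every top-cube up-set (`sStarD_topCube_ge_harris`, generation 19);
the census lists further sporadic ones (k = 3: 16 'edge unions', certs/gen18/ggood_d3.txt).  THIS FILE records the generic consequence, so that
any future Harris-goodness theorem immediately yields an every-dimension slot: **`sStarD_cylSet_nonneg_of_harrisGood`** — if `U` is a Harris-good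
up-set of `[3]^k` then for every `n` and all up-sets `B, C ⊆ [3]^{n+k}`, `0 ≤ sStarD (U × [3]^n) B C` (via `diagCert_N_of_harrisGood`,
`diagCert_T_of_trivial` and `sStarD_cylSet_nonneg_of_diagCert`).  Nothing here asserts `PatternPos d` for any `d ≥ 4`. [this work]
-/

namespace Summit.CriticalPhenomena.PercolationContinuityZ3.Theorems.SahiGridPattern

open Finset SahiGrid3
open scoped BigOperators

variable {n k : ℕ}

/-- Counting form of Harris-goodness: the indicator-sum inequality gives `2^k·#(U∩(B∩C)) ≤ sStarD U B C + #{td pairs in U × (B∩C)}`. [this work] -/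
theorem harrisGood_card {U : Finset (Pd k)}
    (hG : ∀ B C : Finset (Pd k), IsUpperSet (B : Set (Pd k)) → IsUpperSet (C : Set (Pd k)) →
      2 ^ k * (∑ x, ind U x * ind B x * ind C x) ≤
        sStarD U B C + ∑ x, ∑ y, ind U x * ind B y * ind C y * (if TotDist x y = true then (1:ℤ) else 0))
    {B C : Finset (Pd k)} (hB : IsUpperSet (B : Set (Pd k))) (hC : IsUpperSet (C : Set (Pd k))) :
    2 ^ k * ((U ∩ (B ∩ C)).card : ℤ) ≤
      sStarD U B C + (((U ×ˢ (B ∩ C)).filter fun xy => TotDist xy.1 xy.2 = true).card : ℤ) := by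
  have h := hG B C hB hC
  have hBC : ∀ y, ind B y * ind C y = ind (B ∩ C) y := fun y => (ind_inter_eq_mul B C y).symm
  have e1 : (∑ x, ind U x * ind B x * ind C x) = ((U ∩ (B ∩ C)).card : ℤ) := by
    rw [← sum_ind_mul_ind_eq_card]
    exact Finset.sum_congr rfl fun x _ => by rw [mul_assoc, hBC]
  have e2 : (∑ x, ∑ y, ind U x * ind B y * ind C y * (if TotDist x y = true then (1:ℤ) else 0)) =
      ((((U ×ˢ (B ∩ C))).filter fun xy => TotDist xy.1 xy.2 = true).card : ℤ) := by
    rw [← sum_sum_ind_totDist_eq_card]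
    exact Finset.sum_congr rfl fun x _ => Finset.sum_congr rfl fun y _ => by rw [mul_assoc (ind _ x), hBC]
  rw [← e1, ← e2]; exact h

/-- **Condition (N) for the trivial diagonal vector of a Harris-good up-set**: `Θ_U(A×A′) ≤ Σ_{q∈A∩A′} 2^k·1_U(q)`. [this work] -/
theorem diagCert_N_of_harrisGood {U : Finset (Pd k)}
    (hG : ∀ B C : Finset (Pd k), IsUpperSet (B : Set (Pd k)) → IsUpperSet (C : Set (Pd k)) →
      2 ^ k * (∑ x, ind U x * ind B x * ind C x) ≤
        sStarD U B C + ∑ x, ∑ y, ind U x * ind B y * ind C y * (if TotDist x y = true then (1:ℤ) else 0))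
    (A A' : Finset (Pd k)) (hA : IsUpperSet (A : Set (Pd k))) (hA' : IsUpperSet (A' : Set (Pd k))) :
    (∑ q ∈ A, ∑ r ∈ A', thetaVal U q r) ≤ ∑ q ∈ A ∩ A', (2 : ℤ) ^ k * ind U q := by
  have hS := sStarD_eq_sum_lamU_sub_sum_thetaVal U A A'
  have h := harrisGood_card hG hA hA'
  have hnu : (∑ q ∈ A ∩ A', (nuCount U q : ℤ)) = (((U ×ˢ (A ∩ A')).filter fun pq => TotDist pq.1 pq.2 = true).card : ℤ) := by
    unfold nuCount
    rw [Finset.card_filter, Nat.cast_sum, Finset.sum_product, Finset.sum_comm]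
    refine Finset.sum_congr rfl fun q _ => ?_
    rw [Finset.card_filter, Nat.cast_sum]
  have hind : (∑ q ∈ A ∩ A', ind U q) = ((U ∩ (A ∩ A')).card : ℤ) := by
    unfold ind
    rw [Finset.sum_boole, Finset.filter_mem_eq_inter, Finset.inter_comm]
  have hlam : (∑ q ∈ A ∩ A', lamU U q) = 2 * 2 ^ k * (∑ q ∈ A ∩ A', ind U q) - ∑ q ∈ A ∩ A', (nuCount U q : ℤ) := by
    unfold lamU
    rw [Finset.sum_sub_distrib, ← Finset.mul_sum]
  rw [← Finset.mul_sum, hind]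
  rw [hlam, hnu, hind] at hS
  linarith

/-- **EVERY HARRIS-GOOD UP-SET IS A GOOD SLOT IN EVERY DIMENSION**: if `2^k·#(U∩B∩C) ≤ sStarD U B C + N(U;B∩C)` for all up-sets
`B, C ⊆ [3]^k` (with `U` an up-set), then for every `n` and all up-sets `B, C ⊆ [3]^{n+k}`: `0 ≤ sStarD (U × [3]^n) B C`. [this work] -/
theorem sStarD_cylSet_nonneg_of_harrisGood (U : Finset (Pd k)) (hU : IsUpperSet (U : Set (Pd k)))
    (hG : ∀ B C : Finset (Pd k), IsUpperSet (B : Set (Pd k)) → IsUpperSet (C : Set (Pd k)) →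
      2 ^ k * (∑ x, ind U x * ind B x * ind C x) ≤
        sStarD U B C + ∑ x, ∑ y, ind U x * ind B y * ind C y * (if TotDist x y = true then (1:ℤ) else 0))
    {B C : Finset (Pd (n + k))} (hB : IsUpperSet (B : Set (Pd (n + k)))) (hC : IsUpperSet (C : Set (Pd (n + k)))) :
    0 ≤ sStarD (cylSet U : Finset (Pd (n + k))) B C :=
  sStarD_cylSet_nonneg_of_diagCert U (fun q => (2 : ℤ) ^ k * ind U q)
    (fun q => mul_nonneg (pow_nonneg (by norm_num) k) (ind_nonneg' U q))
    (fun W hW => diagCert_T_of_trivial U W hU hW) (fun A A' hA hA' => diagCert_N_of_harrisGood hG A A' hA hA') hB hC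

/-- **Harris-good slots are good** (dimension `k` itself): `0 ≤ sStarD U B C`. [this work] -/
theorem sStarD_nonneg_of_harrisGood (U : Finset (Pd k)) (hU : IsUpperSet (U : Set (Pd k)))
    (hG : ∀ B C : Finset (Pd k), IsUpperSet (B : Set (Pd k)) → IsUpperSet (C : Set (Pd k)) →
      2 ^ k * (∑ x, ind U x * ind B x * ind C x) ≤
        sStarD U B C + ∑ x, ∑ y, ind U x * ind B y * ind C y * (if TotDist x y = true then (1:ℤ) else 0))
    {B C : Finset (Pd k)} (hB : IsUpperSet (B : Set (Pd k))) (hC : IsUpperSet (C : Set (Pd k))) :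
    0 ≤ sStarD U B C := by
  have h := harrisGood_card hG hB hC
  have hH := tdPairs_le_card_inter U (B ∩ C) hU (isUpperSet_inter_coe' hB hC)
  linarith

/-- Instance: the orthant cylinders `↑p × [3]^n` through the Harris-good pipeline (re-derivation of the generation-9 orthant cylinders from
`sStarD_principal_ge_harris`; recorded as a consistency check of the pipeline). [this work] -/
theorem sStarD_cylSet_principal_nonneg' (p : Pd k) {B C : Finset (Pd (n + k))} (hB : IsUpperSet (B : Set (Pd (n + k))))
    (hC : IsUpperSet (C : Set (Pd (n + k)))) :
    0 ≤ sStarD (cylSet (univ.filter fun x : Pd k => ∀ a, p a ≤ x a) : Finset (Pd (n + k))) B C :=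
  sStarD_cylSet_nonneg_of_harrisGood _ (isUpperSet_filter_le p) (fun B' C' hB' hC' => sStarD_principal_ge_harris k p B' C' hB' hC') hB hC

end Summit.CriticalPhenomena.PercolationContinuityZ3.Theorems.SahiGridPattern
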